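import Summits.ResolutionOfSingularities.ResolutionOfSingularities.Theorems.InertDescentLU2
import HarnessLib

/-!
# InvariantDescentLU — decomp-res node «InvariantDescent (lens-1 g28 prep C = ENGINE-2; critic letter row 216a
LANDABLE AT 0, banked toward (W-α) WHOLE)», tree file 1/2 of the node

Content from the decomp-res lens-1 g28 file `HOME/decomp-res-lens-1/g28/land/InvariantDescentLU.lean` (sha256
427ce96f, 607 l = PIN STATUS :1897; HOME = run/shared/lean/pub/decomp-res), LANDING NOTE INBOX :1509 / WRITER-C.md
dabe81aa, critic CRITIC-LEDGER letter row 216a (l.288) «VALID TOOL, LANDABLE AT 0 NOW, banked toward (W-α) WHOLE»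
(INBOX 2026-08-31T11:55:34Z). The file exceeds the tree's 400-line cap, so the writer split it in two at a section
boundary (this file + `InvariantDescentLU2`, which imports it); the one `universe u` line moved from inside the
namespace to the preamble of each part; every declaration VERBATIM up to the writer's lint pass. `--supports
stmt-ResolutionOfSingularities-0641 --as helper` (route Valuative helper files; no route edit); Probe3 stays HOME.

The lens header, verbatim:

> # InvariantDescentLU — regularity at the centre DESCENDS along the quotient by a finite group of
> automorphisms through ONE separating witness (ENGINE-2 of NEXT-g29-B.md Door A′ = critic row 215 (A4):
> «pre-priced LANDABLE AT 0 any time, reusable half of (W-α) WHOLE, banked»; g28 preparation C for g29)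
>
> Frame: a field `E` with a valuation ring `O_E`; a finite set `H` of ring automorphisms of `E` closed under
> composition and containing `1` (a finite group; `O_E` need NOT be `H`-stable — split centres allowed); its
> fixed subfield `K = E^H`; an `H`-stable subring `T₁ ⊆ O_E` with fraction field `E`, REGULAR at the centre
> of `O_E`; ONE element
> `x ∈ T₁` which SEPARATES `H` at the centre (`v(x − h x) = 0` for `h ≠ 1`) and generates `E` over `K`
> (`E = K[x]`).  Conclusion (`isRegularLocalRing_locAtCentre_inf_fixed`): the invariant ring `T₁ ∩ K` is
> regular at the centre, provided its local ring there is Noetherian — which `isNoetherianRing_inf_fixed`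
> (Artin–Tate) supplies when `T₁` is finitely generated over a Noetherian subring of `K`
> (`isRegularLocalRing_locAtCentre_inf_fixed_of_fg`).
>
> Mechanism (no étaleness-of-quotients theorem, no Galois theory beyond the norm `∏_{h ∈ H} h`): the
> characteristic polynomial `f = ∏_{h ∈ H} (X − h x)` has `H`-invariant coefficients in `T := T₁ ∩ K`,
> `f(x) = 0`, `f′(x) = ∏_{h ≠ 1} (x − h x)` a unit of `O_E`: `x` is ONE standard-étale witness over the local
> ring `B = T_𝔪`, which is NORMAL (`B ⊇ (T₁)_𝔪′ ∩ K` by the norm trick with PRIME AVOIDANCE over the conjugate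
> centres `h⁻¹(𝔪′) ∩ T₁`, `(T₁)_𝔪′` regular hence normal);
> g28 PART B (`InertDescentLU.isIntegrallyClosed_locAtCentre_adjoin`) makes `(B[x])_𝔪′` normal, hence
> EQUAL to `(T₁)_𝔪′` (`T₁` is integral over `T` — every `t ∈ T₁` is a root of its characteristic
> polynomial — and `Frac B[x] = K(x) = E`), hence regular; g28 PART A
> (`InertDescentLU.isRegularLocalRing_of_adjoin_integral`, Matsumura 23.7 (i)) descends regularity to `B`.
> (Sources: Matsumura1987, Thm. 23.7 (i) and Thm. 19.4 via the tree; Atiyah–Macdonald Prop. 7.8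
> (Artin–Tate) via Mathlib `fg_of_fg_of_fg`; folklore invariant theory of finite groups.)

## This file

Sections `Group` (the finite automorphism set as a group: closure lemmas), `CharPoly` (`charPoly`, invariance of its
coefficients, `charPoly` kills `x`, derivative at `x`), `Fixed` (the invariant ring `T₁ ⊓ K`, centres, the norm
trick with prime avoidance, `mem_locAtCentre_inf_of_fixed`) — continued in `InvariantDescentLU2` (sections `Normal`,
`Main` = `isIntegrallyClosed_locAtCentre_inf` / `isRegularLocalRing_locAtCentre_inf_fixed`, `ArtinTate` =
`isNoetherianRing_inf_fixed`, `exists_finset_inf_fixed_eq_closure`,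
`isRegularLocalRing_locAtCentre_inf_fixed_of_fg`).  (This first part carries `section Group`, `section CharPoly`,
`section Fixed`: `image_mul_left_eq`, `prod_mul_left_eq`, `apply_prod_eq`, `prod_mem_of_stable`, `inv_mem`,
`valuation_apply_eq_one`, `valuation_prod_eq_one`, `charPoly`, `charPoly_monic`, `charPoly_eval_self`,
`charPoly_coeff_mem`, `charPoly_map_eq`, `apply_coeff_charPoly`, `eval_derivative_charPoly`,
`exists_fixed_fraction`, `exists_fraction_of_mem_fixed`, `mem_locAtCentre_inf_of_fixed`,
`mem_of_isIntegral_of_isIntegrallyClosed` (the lens's `isIntegral_of_le` is inlined, see `InvariantDescentLU2`).)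

[WRITER NOTE (decomp-res writer g13): file split only (tree files ≤ 400 lines); namespace, sections, section
variables / opens and every declaration exactly as in the lens file (the `universe u` line moved to the preamble).]

(Sources: Matsumura1987, Thm. 23.7 (i), Thm. 19.4; AtiyahMacdonald1969, Prop. 7.8 (Artin–Tate) via Mathlib
`fg_of_fg_of_fg`; folklore invariant theory of finite groups; tree: InertDescentLU (g28 PART A/B).)

WRITER NOTE (decomp-res writer g13, dedup): the lens's 4-line helper `isIntegral_of_le` restated the landed
`DecompositionDescentLU.isIntegral_of_subring_le` (tree file `DecompositionDescentLU3`, gate `dedup.landed`); importing that module would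
pull the `Theses.Valuative` closure into this deliberately Theses-free ENGINE file, so the copy is dropped and its proof INLINED at the
single use site (`isIntegrallyClosed_locAtCentre_inf` in `InvariantDescentLU2`); nothing else changed.
-/

open Polynomial Literature.AlgebraicGeometry.Resolution
open Summit.ResolutionOfSingularities.ResolutionOfSingularities.Theorems.InertDescentLU

universe u

namespace Summit.ResolutionOfSingularities.ResolutionOfSingularities.Theorems.InvariantDescentLU

variable {E : Type u} [Field E] (OE : ValuationSubring E)

section Group

variable (H : Finset (E ≃+* E))

/-! ### S1. A finite group of automorphisms given as a `Finset`: reindexing, norms, units -/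

/-- Left multiplication by an element of `H` permutes `H`. [folklore] -/
theorem image_mul_left_eq [DecidableEq (E ≃+* E)] (hmul : ∀ g ∈ H, ∀ h ∈ H, g * h ∈ H)
    {g : E ≃+* E} (hg : g ∈ H) : H.image (fun h => g * h) = H := by
  apply Finset.eq_of_subset_of_card_le
  · exact Finset.image_subset_iff.mpr fun h hh => hmul g hg h hh
  · rw [Finset.card_image_of_injective _ (mul_right_injective g)]

/-- Reindexing a product over `H` by left multiplication. [folklore] -/
theorem prod_mul_left_eq {M : Type*} [CommMonoid M] (hmul : ∀ g ∈ H, ∀ h ∈ H, g * h ∈ H)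
    {g : E ≃+* E} (hg : g ∈ H) (F : (E ≃+* E) → M) :
    ∏ h ∈ H, F (g * h) = ∏ h ∈ H, F h := by
  classical
  conv_rhs => rw [← image_mul_left_eq H hmul hg]
  rw [Finset.prod_image fun a _ b _ hab => mul_right_injective g hab]

/-- The norm `∏_{h ∈ H} h b` is `H`-invariant. [folklore] -/
theorem apply_prod_eq (hmul : ∀ g ∈ H, ∀ h ∈ H, g * h ∈ H) {g : E ≃+* E} (hg : g ∈ H) (b : E) :
    g (∏ h ∈ H, h b) = ∏ h ∈ H, h b := by
  rw [map_prod]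
  exact prod_mul_left_eq H hmul hg fun h => h b

/-- The norm of an element of an `H`-stable subring lies in it. [folklore] -/
theorem prod_mem_of_stable {T₁ : Subring E} (hT₁H : ∀ h ∈ H, ∀ z ∈ T₁, h z ∈ T₁) {b : E}
    (hb : b ∈ T₁) : ∏ h ∈ H, h b ∈ T₁ :=
  Subring.prod_mem _ fun h hh => hT₁H h hh b hb

/-- A finite set of automorphisms closed under composition and containing `1` is closed under
inverses. [folklore] -/
theorem inv_mem (h1 : (1 : E ≃+* E) ∈ H) (hmul : ∀ g ∈ H, ∀ h ∈ H, g * h ∈ H) {h : E ≃+* E}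
    (hh : h ∈ H) : h⁻¹ ∈ H := by
  classical
  have h1' : (1 : E ≃+* E) ∈ H.image (fun g => h * g) := by rw [image_mul_left_eq H hmul hh]; exact h1
  obtain ⟨g, hg, hg1⟩ := Finset.mem_image.mp h1'
  rw [inv_eq_of_mul_eq_one_right hg1]
  exact hg

variable {H}

/-- An automorphism preserving `O_E` (both ways) preserves the units of `O_E`. [folklore] -/
theorem valuation_apply_eq_one {h : E ≃+* E} (hHO : ∀ z : E, z ∈ OE ↔ h z ∈ OE) {s : E}
    (hs : OE.valuation s = 1) : OE.valuation (h s) = 1 := by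
  have hs0 : s ≠ 0 := ne_zero_of_valuation_eq_one hs
  have hsO : s ∈ OE := (OE.valuation_le_one_iff _).mp hs.le
  refine le_antisymm ((OE.valuation_le_one_iff _).mpr ((hHO _).mp hsO)) ?_
  have hsinv : s⁻¹ ∈ OE := by rw [← OE.valuation_le_one_iff, map_inv₀, hs, inv_one]
  have h' := (OE.valuation_le_one_iff _).mpr ((hHO _).mp hsinv)
  rw [map_inv₀, map_inv₀, inv_le_one₀ ((Valuation.pos_iff _).mpr
    (fun e => hs0 (by simpa using congrArg h.symm e)))] at h'
  exact h'

/-- The norm of a unit of `O_E` is a unit of `O_E`. [folklore] -/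
theorem valuation_prod_eq_one (hHO : ∀ h ∈ H, ∀ z : E, z ∈ OE ↔ h z ∈ OE) {s : E}
    (hs : OE.valuation s = 1) : OE.valuation (∏ h ∈ H, h s) = 1 := by
  rw [map_prod]
  exact Finset.prod_eq_one fun h hh => valuation_apply_eq_one OE (hHO h hh) hs

end Group

section CharPoly

variable (H : Finset (E ≃+* E))

/-! ### S2. The characteristic polynomial `∏_{h ∈ H} (X − h t)` -/

/-- The characteristic polynomial of `t` under the finite group `H`: `∏_{h ∈ H} (X − h t)`. [folklore] -/
noncomputable def charPoly (t : E) : E[X] := ∏ h ∈ H, (X - C (h t))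

/-- `charPoly_monic`: Auxiliary step of this node's calculus, VERBATIM from the lens file (see the module
docstring); the statement is its type. [folklore] -/
theorem charPoly_monic (t : E) : (charPoly H t).Monic :=
  monic_prod_of_monic _ _ fun h _ => monic_X_sub_C (h t)

/-- `t` is a root of its characteristic polynomial (factor `h = 1`). [folklore] -/
theorem charPoly_eval_self (h1 : (1 : E ≃+* E) ∈ H) (t : E) : (charPoly H t).eval t = 0 := by
  rw [charPoly, eval_prod]
  exact Finset.prod_eq_zero h1 (by simp)

/-- The characteristic polynomial has coefficients in any subring containing the orbit. [folklore] -/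
theorem charPoly_coeff_mem {S : Subring E} {t : E} (hS : ∀ h ∈ H, h t ∈ S) (i : ℕ) :
    (charPoly H t).coeff i ∈ S := by
  classical
  set f₀ : Polynomial S := ∏ h ∈ H.attach, (X - C (⟨(h : E ≃+* E) t, hS h h.2⟩ : S)) with hf₀
  have hmap : f₀.map S.subtype = charPoly H t := by
    rw [hf₀, Polynomial.map_prod, charPoly, ← Finset.prod_attach H (f := fun h => X - C (h t))]
    refine Finset.prod_congr rfl fun h _ => ?_
    simp
  rw [← hmap, coeff_map]
  exact (f₀.coeff i).2

/-- The characteristic polynomial is `H`-invariant. [folklore] -/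
theorem charPoly_map_eq (hmul : ∀ g ∈ H, ∀ h ∈ H, g * h ∈ H) {g : E ≃+* E} (hg : g ∈ H) (t : E) :
    (charPoly H t).map (g : E →+* E) = charPoly H t := by
  rw [charPoly, Polynomial.map_prod]
  simp only [Polynomial.map_sub, map_X, map_C, RingHom.coe_coe]
  exact prod_mul_left_eq H hmul hg fun h => X - C (h t)

/-- The coefficients of the characteristic polynomial are `H`-fixed. [folklore] -/
theorem apply_coeff_charPoly (hmul : ∀ g ∈ H, ∀ h ∈ H, g * h ∈ H) {g : E ≃+* E} (hg : g ∈ H)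
    (t : E) (i : ℕ) : g ((charPoly H t).coeff i) = (charPoly H t).coeff i := by
  have h := congrArg (fun p : E[X] => p.coeff i) (charPoly_map_eq H hmul hg t)
  simpa [coeff_map] using h

/-- `f′(t) = ∏_{h ≠ 1} (t − h t)` for the characteristic polynomial `f` of `t`. [folklore] -/
theorem eval_derivative_charPoly [DecidableEq (E ≃+* E)] (h1 : (1 : E ≃+* E) ∈ H) (t : E) :
    (derivative (charPoly H t)).eval t = ∏ h ∈ H.erase 1, (t - h t) := by
  rw [charPoly, derivative_prod_finset, eval_finsetSum]
  rw [Finset.sum_eq_single_of_mem (1 : E ≃+* E) h1]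
  · simp [eval_prod]
  · intro a ha ha1
    have h1a : (1 : E ≃+* E) ∈ H.erase a := Finset.mem_erase.mpr ⟨fun e => ha1 e.symm, h1⟩
    rw [eval_mul, eval_prod, Finset.prod_eq_zero h1a (by simp), zero_mul]

end CharPoly

section Fixed

variable {H : Finset (E ≃+* E)} {K : Subfield E} {T₁ : Subring E}

/-! ### S3. The fixed subfield and the norm trick -/

/-- **Norm trick.** A fraction `a / s` (`a, s ∈ T₁`, `s ≠ 0`) fixed by `H` equals `c / N(s)` with
`c = a · ∏_{h ≠ 1} h s` and `N(s) = ∏_{h ∈ H} h s` BOTH in the invariant ring `T₁ ∩ K`. [folklore] -/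
theorem exists_fixed_fraction (h1 : (1 : E ≃+* E) ∈ H) (hmul : ∀ g ∈ H, ∀ h ∈ H, g * h ∈ H)
    (hK : ∀ z, z ∈ K ↔ ∀ h ∈ H, h z = z) (hT₁H : ∀ h ∈ H, ∀ z ∈ T₁, h z ∈ T₁)
    {a s : E} (ha : a ∈ T₁) (hs : s ∈ T₁) (hs0 : s ≠ 0) (hfix : ∀ g ∈ H, g (a / s) = a / s) :
    ∃ c ∈ T₁ ⊓ K.toSubring, (∏ h ∈ H, h s) ∈ T₁ ⊓ K.toSubring ∧ (∏ h ∈ H, h s) ≠ 0 ∧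
      a / s = c / ∏ h ∈ H, h s := by
  classical
  set P : E := ∏ h ∈ H.erase 1, h s with hP
  set N : E := ∏ h ∈ H, h s with hN
  have hNP : s * P = N := by
    rw [hP, hN, ← Finset.mul_prod_erase H (fun h => h s) h1]
    rfl
  have hP0 : P ≠ 0 :=
    Finset.prod_ne_zero_iff.mpr fun h _ => (RingEquiv.map_ne_zero_iff h).mpr hs0
  have hN0 : N ≠ 0 :=
    Finset.prod_ne_zero_iff.mpr fun h _ => (RingEquiv.map_ne_zero_iff h).mpr hs0
  have hPT : P ∈ T₁ :=
    Subring.prod_mem _ fun h hh => hT₁H h (Finset.mem_of_mem_erase hh) s hs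
  have hNfix : ∀ g ∈ H, g N = N := fun g hg => apply_prod_eq H hmul hg s
  have hNT : N ∈ T₁ ⊓ K.toSubring :=
    Subring.mem_inf.mpr ⟨prod_mem_of_stable H hT₁H hs, (hK N).mpr hNfix⟩
  have hc : a * P = a / s * N := by
    rw [← hNP, ← mul_assoc, div_mul_cancel₀ a hs0]
  refine ⟨a * P, Subring.mem_inf.mpr ⟨T₁.mul_mem ha hPT, (hK _).mpr fun g hg => ?_⟩, hNT, hN0, ?_⟩
  · rw [hc, map_mul, hfix g hg, hNfix g hg]
  · rw [← hNP]
    exact (mul_div_mul_right a s hP0).symm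

/-- Elements of the fixed field are fractions of INVARIANT elements, when `T₁` has fraction field `E`.
[folklore] -/
theorem exists_fraction_of_mem_fixed (h1 : (1 : E ≃+* E) ∈ H) (hmul : ∀ g ∈ H, ∀ h ∈ H, g * h ∈ H)
    (hK : ∀ z, z ∈ K ↔ ∀ h ∈ H, h z = z) (hT₁H : ∀ h ∈ H, ∀ z ∈ T₁, h z ∈ T₁)
    (hfrac : ∀ z : E, ∃ a ∈ T₁, ∃ b ∈ T₁, b ≠ 0 ∧ z = a / b) {κ : E} (hκ : κ ∈ K) :
    ∃ a ∈ T₁ ⊓ K.toSubring, ∃ b ∈ T₁ ⊓ K.toSubring, b ≠ 0 ∧ κ = a / b := by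
  obtain ⟨a, ha, s, hs, hs0, rfl⟩ := hfrac κ
  obtain ⟨c, hc, hN, hN0, he⟩ :=
    exists_fixed_fraction h1 hmul hK hT₁H ha hs hs0 (fun g hg => (hK _).mp hκ g hg)
  exact ⟨c, hc, _, hN, hN0, he⟩

/-- **`(T₁)_𝔪′ ∩ K ⊆ (T₁ ∩ K)_𝔪`**: an `H`-fixed element `z` of the local ring of `T₁` at the centre lies in
the local ring of the invariant ring at the centre.  NO stability of `O_E` under `H` is assumed (split primes
allowed): the ideal of denominators of `z` in `T₁` avoids every conjugate centre `h⁻¹(𝔪′) ∩ T₁` (because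
`z = h z`), hence their union (prime avoidance), giving a denominator `d` with ALL `h d` units of `O_E`; then
`z = (d z · ∏_{h ≠ 1} h d) / N(d)` with `N(d) = ∏_h h d` an invariant unit. [folklore] -/
theorem mem_locAtCentre_inf_of_fixed (h1 : (1 : E ≃+* E) ∈ H) (hmul : ∀ g ∈ H, ∀ h ∈ H, g * h ∈ H)
    (hK : ∀ z, z ∈ K ↔ ∀ h ∈ H, h z = z) (hT₁O : T₁ ≤ OE.toSubring)
    (hT₁H : ∀ h ∈ H, ∀ z ∈ T₁, h z ∈ T₁)
    {z : E} (hz : z ∈ locAtCentre T₁ OE) (hfix : ∀ h ∈ H, h z = z) :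
    z ∈ locAtCentre (T₁ ⊓ K.toSubring) OE := by
  classical
  obtain ⟨a, ha, s, hs, hsv, rfl⟩ := mem_locAtCentre_iff.mp hz
  have hs0 : s ≠ 0 := ne_zero_of_valuation_eq_one hsv
  -- the ideal of denominators of `z = a / s` in `T₁`
  let J : Ideal T₁ :=
    { carrier := {d | (d : E) * (a / s) ∈ T₁}
      add_mem' := fun {d₁ d₂} h₁ h₂ => by
        show ((d₁ : E) + d₂) * (a / s) ∈ T₁
        rw [add_mul]; exact T₁.add_mem h₁ h₂
      zero_mem' := by
        show ((0 : T₁) : E) * (a / s) ∈ T₁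
        rw [ZeroMemClass.coe_zero, zero_mul]; exact T₁.zero_mem
      smul_mem' := fun c {d} hd => by
        show ((c : E) * d) * (a / s) ∈ T₁
        rw [mul_assoc]; exact T₁.mul_mem c.2 hd }
  -- the conjugate centres `h⁻¹(𝔪′) ∩ T₁`, as prime ideals of `T₁`
  let ψ : ∀ h ∈ H, T₁ →+* T₁ := fun h hh =>
    (h : E ≃+* E).toRingHom.restrict T₁ T₁ fun d hd => hT₁H h hh d hd
  let P : (E ≃+* E) → Ideal T₁ := fun h =>
    if hh : h ∈ H then (subringCentre T₁ OE hT₁O).comap (ψ h hh) else subringCentre T₁ OE hT₁O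
  have hPprime : ∀ h, (P h).IsPrime := fun h => by
    by_cases hh : h ∈ H
    · simp only [P, dif_pos hh]; exact Ideal.comap_isPrime _ _
    · simp only [P, dif_neg hh]; infer_instance
  have hmemP : ∀ h, ∀ hh : h ∈ H, ∀ d : T₁, d ∈ P h ↔ OE.valuation (h (d : E)) < 1 := by
    intro h hh d
    simp only [P, dif_pos hh, Ideal.mem_comap, mem_subringCentre_iff]
    rfl
  -- `J ⊄ h⁻¹(𝔪′)`: the denominator `h⁻¹ s` of `z = h⁻¹ z` works
  have hJ : ∀ h ∈ H, ¬ J ≤ P h := fun h hh hle => by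
    have hg : h⁻¹ ∈ H := inv_mem H h1 hmul hh
    have hd : (⟨h⁻¹ s, hT₁H _ hg s hs⟩ : T₁) ∈ J := by
      show h⁻¹ s * (a / s) ∈ T₁
      have e : h⁻¹ s * (a / s) = h⁻¹ (s * (a / s)) := by rw [map_mul, hfix _ hg]
      rw [e, ← mul_div_assoc, mul_div_cancel_left₀ a hs0]
      exact hT₁H _ hg a ha
    have hlt := (hmemP h hh _).mp (hle hd)
    change OE.valuation (h (h⁻¹ s)) < 1 at hlt
    have e : h (h⁻¹ s) = s := by
      show (h * h⁻¹) s = s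
      rw [mul_inv_cancel]; rfl
    rw [e, hsv] at hlt
    exact lt_irrefl _ hlt
  -- prime avoidance: one denominator off ALL the conjugate centres
  have havoid : ¬ ((J : Set T₁) ⊆ ⋃ i ∈ (↑H : Set (E ≃+* E)), (P i : Set T₁)) := by
    rw [Ideal.subset_union_prime (1 : E ≃+* E) (1 : E ≃+* E) fun i _ _ _ => hPprime i]
    rintro ⟨i, hi, hle⟩
    exact hJ i hi hle
  obtain ⟨d, hdJ, hdP⟩ := Set.not_subset.mp havoid
  have hdv : ∀ h ∈ H, OE.valuation (h (d : E)) = 1 := fun h hh => by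
    have hn : d ∉ P h := fun hm =>
      hdP (Set.mem_iUnion₂.mpr ⟨h, Finset.mem_coe.mpr hh, hm⟩)
    rw [hmemP h hh, not_lt] at hn
    exact le_antisymm ((OE.valuation_le_one_iff _).mpr (hT₁O (hT₁H h hh _ d.2))) hn
  -- assemble `z = (d z · ∏_{h ≠ 1} h d) / N(d)`
  set N : E := ∏ h ∈ H, h (d : E) with hN
  have hNv : OE.valuation N = 1 := by
    rw [hN, map_prod]
    exact Finset.prod_eq_one fun h hh => hdv h hh
  have hN0 : N ≠ 0 := ne_zero_of_valuation_eq_one hNv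
  have hNfix : ∀ g ∈ H, g N = N := fun g hg => apply_prod_eq H hmul hg d
  have hNT : N ∈ T₁ ⊓ K.toSubring :=
    Subring.mem_inf.mpr ⟨prod_mem_of_stable H hT₁H d.2, (hK N).mpr hNfix⟩
  set c : E := N * (a / s) with hc
  have hcT₁ : c ∈ T₁ := by
    have e : c = ((d : E) * (a / s)) * ∏ h ∈ H.erase 1, h (d : E) := by
      rw [hc, hN, ← Finset.mul_prod_erase H (fun h => h (d : E)) h1]
      show ((1 : E ≃+* E) (d : E) * ∏ h ∈ H.erase 1, h (d : E)) * (a / s) = _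
      rw [RingAut.one_apply]
      ring
    rw [e]
    exact T₁.mul_mem hdJ
      (Subring.prod_mem _ fun h hh => hT₁H h (Finset.mem_of_mem_erase hh) _ d.2)
  have hcfix : ∀ g ∈ H, g c = c := fun g hg => by
    rw [hc, map_mul, hNfix g hg, hfix g hg]
  refine mem_locAtCentre_iff.mpr ⟨c, Subring.mem_inf.mpr ⟨hcT₁, (hK c).mpr hcfix⟩, N, hNT, hNv, ?_⟩
  rw [hc]
  exact (mul_div_cancel_left₀ (a / s) hN0).symm

end Fixed

/-! ### S4. Integrally closed subrings with a given fraction field; the invariant local ring is normal -/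

/-- If a subring `A ⊆ E` is integrally closed and `E` is its fraction field, every element of `E` integral
over `A` lies in `A`. [folklore] -/
theorem mem_of_isIntegral_of_isIntegrallyClosed (A : Subring E) [IsIntegrallyClosed A]
    (hA : ∀ z : E, ∃ a ∈ A, ∃ b ∈ A, b ≠ 0 ∧ z = a / b) {z : E} (hz : IsIntegral A z) : z ∈ A := by
  haveI : FaithfulSMul A E := (faithfulSMul_iff_algebraMap_injective A E).mpr Subtype.val_injective
  haveI : IsFractionRing A E := by
    refine IsFractionRing.of_field A E fun w => ?_
    obtain ⟨a, ha, b, hb, -, hw⟩ := hA w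
    exact ⟨⟨a, ha⟩, ⟨b, hb⟩, hw⟩
  obtain ⟨y, hy⟩ := (IsIntegrallyClosed.isIntegral_iff (R := A) (K := E)).mp hz
  rw [← hy]
  exact y.2

end Summit.ResolutionOfSingularities.ResolutionOfSingularities.Theorems.InvariantDescentLU
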